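import Summits.QuantumFields.BalabanUV.T4Continuum.Support.VariationalCovariantUpper

/-!
# T⁴ programme, spine node NE2 (U1a), lane P2 — THE UPPER HALF AND THE UB⁺ TOWER WITH LEAF ONE⁺ IN ITS HONEST COVARIANT SHAPE
# `T_{Q₁}Sf (f) ≤ (√(Sc f + ε₁·ρ f) + δ′·√(qW f))²` (the Grönwall recursion `Λ_{k+1} + 1 = (Λ_k + 1)(1 + e_k)` survives with
# `e_k = ε₁C_R + 2δ′√((1 + ε₁C_R)·C_P) + δ′²C_P`)

NE2 formalisation swarm `b2b-balaban-t4-ne2-formalise-*`, leaf 01 GEN 2 (`prover-b2b-balaban-t4-ne2-formalise-leaf-01-g2-0`), SUPPLIER SEAT for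
leaf ONE⁺ («s5») of the P2 (variational) skeleton `t4/skeletons/NE2-t4-ne2-p2.md` v0.8 §2.C; journal CLAIM CLAIMS.log l.8374, RESULT l.8788.  This
file is a VARIANT of the road owner's `VariationalCovariantUpper` (p212189: `upper_half`, `fine_ub_of_coarse`, `LamSeq`, `ub_tower`), importing it
BY NAME (`LamSeq` and its Grönwall lemmas are REUSED, not restated) and changing ONE binder: leaf ONE⁺ is taken in the shape the explicit
covariant competitor delivers (`VariationalCovariantOneStepPhys.blockSpin_Q1_le`),

  `hONE′ : ∀ f, blockSpin Q₁ Sf f ≤ (√(Sc f + ε₁·ρ f) + δ′·√(qW f))²`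

(the one-step transport defect `δ′` enters linearly inside the square — first order in the field strength, the order the owner's numerics see,
N-ne2p2g10-1).  At the coarse minimiser the square-root shape costs `(ε₁C_R + 2δ′√((1 + ε₁C_R)·C_P) + δ′²C_P)·(Λ + 1)·qZ μ` (`upper_half_sqrt`,
via the owner's `defect_bound` and `√((Λ+1)²·c) = (Λ+1)·√c`), which has EXACTLY the multiplicative form the tower recursion needs: UB⁺ at level 0
+ (P⁺, ONE⁺-sqrt, REG⁺) at every level ⟹ UB⁺ at every level with `Λ_k = LamSeq Λ₀ e`, `e_k = ε₁,k·C_R + 2δ′_k·√((1 + ε₁,k·C_R)·C_P) + δ′_k²·C_P`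
(`ub_tower_sqrt`) — uniformly bounded by the owner's `LamSeq_add_one_le` when `Σ_k e_k < ∞` (`ε₁,k ≍ L·n_k⁻²`, `δ′_k ≍ α·L·n_k⁻¹`: both geometric).

HONEST FRAMING (T4-DAG p. 1).  Rung (B)+1 only — NOT infinite volume, NOT a mass gap, NOT Clay.  NE2 is NOT IN PRINT and NOT proved here;
this is route COMPOSITION on abstract carriers; P⁺, ONE⁺ (sqrt shape), REG⁺, UB⁺ at level 0 are HYPOTHESES of this file; nothing printed
is a hypothesis; no `def`; no `sorry`; axioms standard.  HONEST DEPENDENCY (cell, verbatim): continuum YM on T⁴ ⇐ BetaPertH ∧ nine spine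
estimates (0/9 proved); BetaPertH ⇐ (D1) ∧ (D4) ∧ CAP+tail; G-an2-4 gates asym, D1 and NE2/3/4.
-/

noncomputable section

namespace Summit.QuantumFields.BalabanUV.T4Continuum.VariationalCovariantUpperSqrt

open Set Finset
open Summit.QuantumFields.BalabanUV.T4Continuum.VariationalTransfer
open Summit.QuantumFields.BalabanUV.T4Continuum.VariationalAdditive
open Summit.QuantumFields.BalabanUV.T4Continuum.VariationalCovariantAssembly (exists_isMinOn_fib defect_bound)
open Summit.QuantumFields.BalabanUV.T4Continuum.VariationalCovariantUpper (LamSeq LamSeq_succ_add_one)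

/-! ## §1 The upper half with ONE⁺ in the square-root shape -/

section OneStep

variable {V W Z : Type*} [NormedAddCommGroup V] [ProperSpace V] [NormedAddCommGroup W] [ProperSpace W] [TopologicalSpace Z] [T1Space Z]

omit [NormedAddCommGroup V] [ProperSpace V] [NormedAddCommGroup W] [ProperSpace W] [TopologicalSpace Z] [T1Space Z] in
/-- the defect of the square-root shape at a field of controlled size: if `s ≤ (1 + ε₁C_R)(Λ+1)·z`, `v ≤ C_P(Λ+1)·z` (`Λ + 1, z ≥ 0`), then
`2√s·δ′√v + δ′²·v ≤ (2δ′√((1 + ε₁C_R)·C_P) + δ′²C_P)·(Λ+1)·z`. [folklore] -/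
theorem sqrt_defect_le {s v z Λ CP A δ' : ℝ} (hδ' : 0 ≤ δ') (hA : 0 ≤ A) (hCP : 0 ≤ CP) (hΛ1 : 0 ≤ Λ + 1) (hz : 0 ≤ z)
    (hs : s ≤ A * (Λ + 1) * z) (hv : v ≤ CP * (Λ + 1) * z) :
    2 * Real.sqrt s * (δ' * Real.sqrt v) + δ' ^ 2 * v ≤ (2 * δ' * Real.sqrt (A * CP) + δ' ^ 2 * CP) * (Λ + 1) * z := by
  have hd := defect_bound (s := s) (v := v) (z := z) (Λ := A * (Λ + 1)) (P := CP * (Λ + 1)) (δ := δ') hδ' (by positivity) (by positivity)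
    hz hs hv
  have hsq : Real.sqrt (A * (Λ + 1) * (CP * (Λ + 1))) = (Λ + 1) * Real.sqrt (A * CP) := by
    rw [show A * (Λ + 1) * (CP * (Λ + 1)) = (Λ + 1) ^ 2 * (A * CP) by ring, Real.sqrt_mul (sq_nonneg _), Real.sqrt_sq hΛ1]
  rw [hsq] at hd
  calc _ ≤ _ := hd
    _ = (2 * δ' * Real.sqrt (A * CP) + δ' ^ 2 * CP) * (Λ + 1) * z := by ring

omit [NormedAddCommGroup V] [ProperSpace V] in
/-- **UPPER HALF OF THE BRACKET, ONE⁺ IN THE SQUARE-ROOT SHAPE** from UB⁺ (coarse), P⁺ (coarse), ONE⁺-sqrt, REG⁺: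
`T_{Qk∘Q₁} Sf (μ) ≤ T_{Qk} Sc (μ) + (ε₁C_R + 2δ′√((1 + ε₁C_R)·C_P) + δ′²C_P)·(Λ+1)·qZ μ`. [folklore] -/
theorem upper_half_sqrt
    {Qk : W → Z} {Q₁ : V → W} {Sc : W → ℝ} {Sf : V → ℝ} {qW : W → ℝ} {qZ : Z → ℝ} {ρ : W → ℝ}
    (hQk : Continuous Qk) (hSc : Continuous Sc) (hsurj : Function.Surjective Q₁)
    (hSc0 : ∀ f, 0 ≤ Sc f) (hSf0 : ∀ f', 0 ≤ Sf f') (hqW0 : ∀ f, 0 ≤ qW f) (hqZ0 : ∀ μ, 0 ≤ qZ μ) (hρ0 : ∀ f, 0 ≤ ρ f)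
    {κ Λ CP CR ε₁ δ' : ℝ} (hκ : 0 ≤ κ) (hΛ : 0 ≤ Λ) (hCP : 0 ≤ CP) (hCR : 0 ≤ CR) (hε₁ : 0 ≤ ε₁) (hδ' : 0 ≤ δ')
    (hnormW : ∀ f, ‖f‖ ^ 2 ≤ κ * qW f)
    (hUBc : ∀ μ, ∃ f, Qk f = μ ∧ Sc f ≤ Λ * qZ μ)
    (hPc : ∀ f, qW f ≤ CP * (Sc f + qZ (Qk f)))
    (hONE : ∀ f, blockSpin Q₁ Sf f ≤ (Real.sqrt (Sc f + ε₁ * ρ f) + δ' * Real.sqrt (qW f)) ^ 2)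
    (hREG : ∀ μ f, Qk f = μ → (∀ g, Qk g = μ → Sc f ≤ Sc g) → ρ f ≤ CR * (Sc f + qZ μ))
    (μ : Z) :
    blockSpin (Qk ∘ Q₁) Sf μ ≤ blockSpin Qk Sc μ
      + ((ε₁ * CR + 2 * δ' * Real.sqrt ((1 + ε₁ * CR) * CP) + δ' ^ 2 * CP) * (Λ + 1)) * qZ μ := by
  obtain ⟨fU, hfU, hfUb⟩ := hUBc μ
  obtain ⟨f₀, hf₀, hmin⟩ := exists_isMinOn_fib (qZ := qZ) hQk hSc hκ hCP hnormW hPc hfU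
  have hz : 0 ≤ qZ μ := hqZ0 μ
  have hSc_le : Sc f₀ ≤ Λ * qZ μ := (hmin fU hfU).trans hfUb
  have hqW_le : qW f₀ ≤ CP * (Λ + 1) * qZ μ := by
    calc qW f₀ ≤ CP * (Sc f₀ + qZ (Qk f₀)) := hPc f₀
      _ ≤ CP * (Λ * qZ μ + qZ μ) := by rw [hf₀]; gcongr
      _ = CP * (Λ + 1) * qZ μ := by ring
  have hρ_le : ρ f₀ ≤ CR * (Λ + 1) * qZ μ := by
    calc ρ f₀ ≤ CR * (Sc f₀ + qZ μ) := hREG μ f₀ hf₀ hmin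
      _ ≤ CR * (Λ * qZ μ + qZ μ) := by gcongr
      _ = CR * (Λ + 1) * qZ μ := by ring
  have hs0 : 0 ≤ Sc f₀ + ε₁ * ρ f₀ := add_nonneg (hSc0 f₀) (mul_nonneg hε₁ (hρ0 f₀))
  have hs : Sc f₀ + ε₁ * ρ f₀ ≤ (1 + ε₁ * CR) * (Λ + 1) * qZ μ := by
    nlinarith [hSc_le, mul_le_mul_of_nonneg_left hρ_le hε₁, mul_nonneg hΛ hz]
  have hερ : ε₁ * ρ f₀ ≤ ε₁ * CR * (Λ + 1) * qZ μ := by nlinarith [mul_le_mul_of_nonneg_left hρ_le hε₁]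
  have hdef := sqrt_defect_le (s := Sc f₀ + ε₁ * ρ f₀) (v := qW f₀) (z := qZ μ) (Λ := Λ) (CP := CP) (A := 1 + ε₁ * CR)
    hδ' (by positivity) hCP (by linarith) hz hs hqW_le
  have hc : blockSpin Q₁ Sf f₀ ≤ Sc f₀ + ((ε₁ * CR + 2 * δ' * Real.sqrt ((1 + ε₁ * CR) * CP) + δ' ^ 2 * CP) * (Λ + 1)) * qZ μ := by
    have h := hONE f₀
    rw [add_sq, Real.sq_sqrt hs0, mul_pow, Real.sq_sqrt (hqW0 f₀)] at h
    have e : ((ε₁ * CR + 2 * δ' * Real.sqrt ((1 + ε₁ * CR) * CP) + δ' ^ 2 * CP) * (Λ + 1)) * qZ μ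
        = ε₁ * CR * (Λ + 1) * qZ μ + (2 * δ' * Real.sqrt ((1 + ε₁ * CR) * CP) + δ' ^ 2 * CP) * (Λ + 1) * qZ μ := by ring
    rw [e]
    linarith
  rw [blockSpin_comp hsurj hSf0]
  exact blockSpin_upper_additive (fun _ => blockSpin_nonneg' hSf0) hSc0 hf₀ hmin hc

/-- **THE FINE-LEVEL UB⁺ FOLLOWS** (witness = the fine minimiser): `∀ μ, ∃ g, Qk (Q₁ g) = μ ∧ Sf g ≤ (Λ + e·(Λ+1))·qZ μ`,
`e = ε₁C_R + 2δ′√((1 + ε₁C_R)·C_P) + δ′²C_P`. [folklore] -/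
theorem fine_ub_of_coarse_sqrt
    {Qk : W → Z} {Q₁ : V → W} {Sc : W → ℝ} {Sf : V → ℝ} {qW : W → ℝ} {qV : V → ℝ} {qZ : Z → ℝ} {ρ : W → ℝ}
    (hQk : Continuous Qk) (hQ₁ : Continuous Q₁) (hSc : Continuous Sc) (hSf : Continuous Sf) (hsurj : Function.Surjective Q₁)
    (hSc0 : ∀ f, 0 ≤ Sc f) (hSf0 : ∀ f', 0 ≤ Sf f') (hqW0 : ∀ f, 0 ≤ qW f) (hqZ0 : ∀ μ, 0 ≤ qZ μ) (hρ0 : ∀ f, 0 ≤ ρ f)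
    {κW κV Λ CP CR ε₁ δ' : ℝ} (hκW : 0 ≤ κW) (hκV : 0 ≤ κV) (hΛ : 0 ≤ Λ) (hCP : 0 ≤ CP) (hCR : 0 ≤ CR) (hε₁ : 0 ≤ ε₁) (hδ' : 0 ≤ δ')
    (hnormW : ∀ f, ‖f‖ ^ 2 ≤ κW * qW f) (hnormV : ∀ f', ‖f'‖ ^ 2 ≤ κV * qV f')
    (hUBc : ∀ μ, ∃ f, Qk f = μ ∧ Sc f ≤ Λ * qZ μ)
    (hPc : ∀ f, qW f ≤ CP * (Sc f + qZ (Qk f))) (hPf : ∀ f', qV f' ≤ CP * (Sf f' + qZ (Qk (Q₁ f'))))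
    (hONE : ∀ f, blockSpin Q₁ Sf f ≤ (Real.sqrt (Sc f + ε₁ * ρ f) + δ' * Real.sqrt (qW f)) ^ 2)
    (hREG : ∀ μ f, Qk f = μ → (∀ g, Qk g = μ → Sc f ≤ Sc g) → ρ f ≤ CR * (Sc f + qZ μ))
    (μ : Z) :
    ∃ g, Qk (Q₁ g) = μ ∧ Sf g ≤ (Λ + (ε₁ * CR + 2 * δ' * Real.sqrt ((1 + ε₁ * CR) * CP) + δ' ^ 2 * CP) * (Λ + 1)) * qZ μ := by
  obtain ⟨fU, hfU, hfUb⟩ := hUBc μ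
  obtain ⟨g₁, hg₁⟩ := hsurj fU
  have hg₁' : (Qk ∘ Q₁) g₁ = μ := by simp [hg₁, hfU]
  have hPf' : ∀ f', qV f' ≤ CP * (Sf f' + qZ ((Qk ∘ Q₁) f')) := fun f' => by simpa using hPf f'
  obtain ⟨g₀, hg₀, hmin'⟩ := exists_isMinOn_fib (Q := Qk ∘ Q₁) (qZ := qZ) (hQk.comp hQ₁) hSf hκV hCP hnormV hPf' hg₁'
  refine ⟨g₀, by simpa using hg₀, ?_⟩
  have hval : blockSpin (Qk ∘ Q₁) Sf μ = Sf g₀ := blockSpin_eq_of_isMin hSf0 hg₀ hmin'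
  have hup := upper_half_sqrt (Λ := Λ) hQk hSc hsurj hSc0 hSf0 hqW0 hqZ0 hρ0 hκW hΛ hCP hCR hε₁ hδ' hnormW hUBc hPc hONE hREG μ
  have hcoarse : blockSpin Qk Sc μ ≤ Λ * qZ μ := (blockSpin_le hSc0 hfU).trans hfUb
  rw [← hval]
  linarith

end OneStep

/-! ## §2 UB⁺ along the whole tower from level 0, ONE⁺ in the square-root shape (the owner's `LamSeq`, by name) -/

section Tower

/-- `Λ k ≥ 0` along the recursion for `Λ₀ ≥ 0` and nonnegative defects. [folklore] -/
theorem LamSeq_nonneg {Λ₀ : ℝ} {e : ℕ → ℝ} (hΛ₀ : 0 ≤ Λ₀) (he : ∀ j, 0 ≤ e j) : ∀ k, 0 ≤ LamSeq Λ₀ e k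
  | 0 => by simpa [LamSeq] using hΛ₀
  | k + 1 => by
    have hk := LamSeq_nonneg hΛ₀ he k
    simp only [LamSeq]
    nlinarith [he k]

variable {Z : Type*} [TopologicalSpace Z] [T1Space Z]

/-- **UB⁺ ALONG THE TOWER, ONE⁺ IN THE SQUARE-ROOT SHAPE**: as `VariationalCovariantUpper.ub_tower`, with
`hONE′ : ∀ k f, blockSpin (Q₁ k) (S (k+1)) f ≤ (√(S k f + ε₁ k·ρ k f) + δ′ k·√(q k f))²` ⟹ UB⁺ at every level with
`Λ = LamSeq Λ₀ (k ↦ ε₁ k·C_R + 2δ′ k·√((1 + ε₁ k·C_R)·C_P) + (δ′ k)²·C_P)` — the owner's Grönwall bound `LamSeq_add_one_le` applies verbatim. [folklore] -/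
theorem ub_tower_sqrt {W : ℕ → Type*} [∀ k, NormedAddCommGroup (W k)] [∀ k, ProperSpace (W k)]
    {Q₁ : ∀ k, W (k + 1) → W k} {Qk : ∀ k, W k → Z} (hcomp : ∀ k, Qk (k + 1) = Qk k ∘ Q₁ k)
    {S : ∀ k, W k → ℝ} {q : ∀ k, W k → ℝ} {ρ : ∀ k, W k → ℝ} {qZ : Z → ℝ}
    (hQk : ∀ k, Continuous (Qk k)) (hQ₁ : ∀ k, Continuous (Q₁ k)) (hS : ∀ k, Continuous (S k)) (hsurj : ∀ k, Function.Surjective (Q₁ k))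
    (hS0 : ∀ k f, 0 ≤ S k f) (hq0 : ∀ k f, 0 ≤ q k f) (hρ0 : ∀ k f, 0 ≤ ρ k f) (hqZ0 : ∀ μ, 0 ≤ qZ μ)
    {κ : ℕ → ℝ} {CP CR Λ₀ : ℝ} {ε₁ δ' : ℕ → ℝ} (hκ : ∀ k, 0 ≤ κ k) (hCP : 0 ≤ CP) (hCR : 0 ≤ CR) (hΛ₀ : 0 ≤ Λ₀)
    (hε₁ : ∀ k, 0 ≤ ε₁ k) (hδ' : ∀ k, 0 ≤ δ' k)
    (hnorm : ∀ k (f : W k), ‖f‖ ^ 2 ≤ κ k * q k f)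
    (hP : ∀ k (f : W k), q k f ≤ CP * (S k f + qZ (Qk k f)))
    (hONE : ∀ k (f : W k), blockSpin (Q₁ k) (S (k + 1)) f ≤ (Real.sqrt (S k f + ε₁ k * ρ k f) + δ' k * Real.sqrt (q k f)) ^ 2)
    (hREG : ∀ k μ (f : W k), Qk k f = μ → (∀ g, Qk k g = μ → S k f ≤ S k g) → ρ k f ≤ CR * (S k f + qZ μ))
    (hUB0 : ∀ μ, ∃ f : W 0, Qk 0 f = μ ∧ S 0 f ≤ Λ₀ * qZ μ) :
    ∀ k μ, ∃ f : W k, Qk k f = μ ∧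
      S k f ≤ LamSeq Λ₀ (fun j => ε₁ j * CR + 2 * δ' j * Real.sqrt ((1 + ε₁ j * CR) * CP) + δ' j ^ 2 * CP) k * qZ μ := by
  have he : ∀ j, 0 ≤ ε₁ j * CR + 2 * δ' j * Real.sqrt ((1 + ε₁ j * CR) * CP) + δ' j ^ 2 * CP := fun j => by
    have := hε₁ j; have := hδ' j; positivity
  intro k
  induction k with
  | zero => simpa [LamSeq] using hUB0
  | succ k ih =>
    intro μ
    have hPf : ∀ f' : W (k + 1), q (k + 1) f' ≤ CP * (S (k + 1) f' + qZ (Qk k (Q₁ k f'))) := by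
      intro f'
      have h := hP (k + 1) f'
      rwa [hcomp k] at h
    have hΛk : 0 ≤ LamSeq Λ₀ (fun j => ε₁ j * CR + 2 * δ' j * Real.sqrt ((1 + ε₁ j * CR) * CP) + δ' j ^ 2 * CP) k :=
      LamSeq_nonneg hΛ₀ he k
    obtain ⟨g, hg, hgb⟩ := fine_ub_of_coarse_sqrt (Qk := Qk k) (Q₁ := Q₁ k) (Sc := S k) (Sf := S (k + 1)) (qW := q k) (qV := q (k + 1))
      (qZ := qZ) (ρ := ρ k) (Λ := LamSeq Λ₀ (fun j => ε₁ j * CR + 2 * δ' j * Real.sqrt ((1 + ε₁ j * CR) * CP) + δ' j ^ 2 * CP) k)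
      (hQk k) (hQ₁ k) (hS k) (hS (k + 1)) (hsurj k) (hS0 k) (hS0 (k + 1)) (hq0 k) hqZ0 (hρ0 k) (hκ k) (hκ (k + 1)) hΛk hCP hCR
      (hε₁ k) (hδ' k) (hnorm k) (hnorm (k + 1)) ih (hP k) hPf (hONE k) (hREG k) μ
    refine ⟨g, by rw [hcomp k]; exact hg, ?_⟩
    simpa [LamSeq] using hgb

end Tower

end Summit.QuantumFields.BalabanUV.T4Continuum.VariationalCovariantUpperSqrt

end
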